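import Mathlib.NumberTheory.Padics.Complex
import Mathlib.NumberTheory.Padics.PadicIntegers
import Mathlib.Analysis.Normed.Unbundled.SpectralNorm
import Mathlib.Analysis.Normed.Algebra.Basic
import Mathlib.Analysis.Normed.Module.FiniteDimension
import Mathlib.RingTheory.DiscreteValuationRing.TFAE
import Mathlib.RingTheory.DedekindDomain.IntegralClosure
import Mathlib.FieldTheory.Minpoly.IsIntegrallyClosed
import Mathlib.RingTheory.Valuation.Integral
import Mathlib.Topology.Algebra.Valued.NormedValued
import HarnessLib

/-!
# The ring of integers of a finite subextension `E` of `ℚ̄_p/ℚ_p` is a discrete valuation ring, and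
# discrete valuation rings over it inside finite extensions of `E` are read off the `p`-adic norm

Topic `Literature/NumberTheory/GaloisRepresentations`; theorems only (no definition, no named fact,
no instance; D-0026).  Throughout `ℚ̄_p = PadicAlgCl p` is Mathlib's algebraic closure of `ℚ_[p]`
with its spectral (`p`-adic) norm, `E ⊆ ℚ̄_p` an intermediate field finite over `ℚ_[p]` (with the
induced norm, Mathlib's instance on intermediate fields of a normed algebra), and
`𝒪_E = {x ∈ E : ‖x‖ ≤ 1}` its closed unit ball, written as the valuation subring of the restriction
of the `p`-adic valuation `Valued.v` of `ℚ̄_p`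
(`(Valued.v.comap (algebraMap E ℚ̄_p)).valuationSubring`; no new definition is introduced).

* `spectralNorm_le_one_iff_isIntegral` — for an integrally closed domain `R` with fraction field a
  normed field `K` whose closed unit ball is `R`, and `L/K` a field extension:
  `|y|_sp ≤ 1 ↔ y` is integral over `R` (`|·|_sp` the spectral norm; both sides say that the
  minimal polynomial of `y` over `K` has coefficients of norm `≤ 1`, Mathlib
  `spectralValue_le_one_iff`, `minpoly.isIntegrallyClosed_eq_field_fractions'`).
* `PadicAlgCl.norm_le_one_iff_isIntegral` — `‖y‖ ≤ 1 ↔ y ∈ ℚ̄_p` is integral over `ℤ_p`.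
* `PadicAlgCl.mem_unitBall_iff`, `unitBall_toSubring_eq_integralClosure`,
  `isNoetherianRing_unitBall`, **`isDiscreteValuationRing_unitBall`**,
  `mem_maximalIdeal_unitBall_iff` (`𝔪_E = {‖x‖ < 1}`), `natCast_mem_maximalIdeal_unitBall`
  (`p ∈ 𝔪_E`), `completeSpace`,
  `isUltrametricDist` — `𝒪_E` is the integral closure of `ℤ_p` in `E`, hence Noetherian
  (Mathlib `integralClosure.isNoetherianRing`), and a Noetherian valuation ring which is not a field
  is a discrete valuation ring (Mathlib `IsDiscreteValuationRing.TFAE`); Serre, *Local Fields*,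
  Ch. II §2, Prop. 3.
* **`PadicAlgCl.norm_algebraMap_le_one_of_dvr`** — the transport statement used to read
  congruences produced by Deligne–Serre's lifting lemma (which outputs an abstract discrete
  valuation ring `𝒪' ⊇ 𝒪_E` with fraction field `K'` finite over `E`) back in `ℚ̄_p`: for every
  `E`-embedding `φ : K' → ℚ̄_p`, `‖φ(y)‖ ≤ 1` for `y ∈ 𝒪'` and `‖φ(y)‖ < 1` for `y ∈ 𝔪'`, provided
  `p ∈ 𝔪'`.  Proof: `E` is complete, so the spectral norm of `K'/E` is multiplicative (Mathlib
  `spectralNorm.normedField`) and its unit ball `A'` is a valuation ring, equal to the integral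
  closure of `𝒪_E` (first item) hence Noetherian, hence a discrete valuation ring; `A' ⊆ 𝒪'`
  (`𝒪'` is integrally closed) and a discrete valuation ring is maximal among proper valuation
  subrings (Mathlib `ValuationSubring.eq_of_le_of_ne_top`), so `𝒪' = A'`; finally the norm of
  `ℚ̄_p` is the spectral norm over the complete field `E` (Mathlib
  `NormedAlgebra.norm_eq_spectralNorm`), which is invariant under `E`-embeddings.  This is the
  uniqueness of the extension of the valuation of a complete field to a finite extension (Serre,
  *Local Fields*, Ch. II §2, Prop. 3 and Cor. 2; Neukirch, *Algebraic Number Theory*, II (4.8)).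

## References

* J.-P. Serre, *Local Fields*, GTM 67 (1979), Ch. II §2, Prop. 3, Cor. 2. [SerreLocalFields1979]
* J. Neukirch, *Algebraic Number Theory* (1999), Ch. II (4.8), (6.2). [NeukirchANT1999]
* S. Bosch, U. Güntzer, R. Remmert, *Non-Archimedean Analysis* (1984), 3.2 (spectral norm).
-/

noncomputable section

open scoped NNReal
open Polynomial IsLocalRing

namespace Literature.NumberTheory.GaloisRepresentations

/-! ### The unit ball of the spectral norm and integrality -/

section UnitBall

variable {K : Type*} [NormedField K] {L : Type*} [Field L] [Algebra K L]
  {R : Type*} [CommRing R] [IsDomain R] [IsIntegrallyClosed R] [Algebra R K] [IsFractionRing R K]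
  [Algebra R L] [IsScalarTower R K L]

/-- **Unit ball of the spectral norm = integral elements.**  Let `R` be an integrally closed domain
with fraction field the normed field `K`, and assume the closed unit ball of `K` is (the image of)
`R`.  For `y` in a field extension `L` of `K`, integral over `K`, the spectral norm of `y` is `≤ 1`
iff `y` is integral over `R`: both say that the minimal polynomial of `y` over `K` — which for `y`
integral over `R` is the minimal polynomial over `R` (Mathlib
`minpoly.isIntegrallyClosed_eq_field_fractions'`) — has coefficients of norm `≤ 1` (Mathlib
`spectralValue_le_one_iff`). (Bosch–Güntzer–Remmert 3.2; Neukirch II (4.8), (6.2).) [folklore] -/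
theorem spectralNorm_le_one_iff_isIntegral
    (hR : ∀ x : K, ‖x‖ ≤ 1 ↔ x ∈ (algebraMap R K).range) {y : L} (hy : IsIntegral K y) :
    spectralNorm K L y ≤ 1 ↔ IsIntegral R y := by
  constructor
  · intro h
    rw [spectralNorm, spectralValue_le_one_iff (minpoly.monic hy)] at h
    have hlifts : minpoly K y ∈ Polynomial.lifts (algebraMap R K) := by
      rw [Polynomial.lifts_iff_coeff_lifts]
      intro n
      obtain ⟨r, hr⟩ := RingHom.mem_range.mp ((hR _).mp (h n))
      exact ⟨r, hr⟩
    obtain ⟨Q, hQmap, -, hQmonic⟩ :=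
      Polynomial.lifts_and_natDegree_eq_and_monic hlifts (minpoly.monic hy)
    refine ⟨Q, hQmonic, ?_⟩
    have h0 : Polynomial.aeval y (Q.map (algebraMap R K)) = 0 := by rw [hQmap, minpoly.aeval]
    rwa [Polynomial.aeval_map_algebraMap] at h0
  · intro h
    rw [spectralNorm, minpoly.isIntegrallyClosed_eq_field_fractions' K h,
      spectralValue_le_one_iff ((minpoly.monic h).map _)]
    intro n
    rw [Polynomial.coeff_map]
    exact (hR _).mpr ⟨_, rfl⟩

end UnitBall

/-! ### `ℚ̄_p`: the unit ball is the integral closure of `ℤ_p` -/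

namespace PadicAlgCl

variable {p : ℕ} [Fact p.Prime]


/-- **`‖y‖ ≤ 1 ↔ y` is integral over `ℤ_p`**, for `y ∈ ℚ̄_p` (the norm of `ℚ̄_p` is the spectral
norm over `ℚ_p`, whose unit ball is `ℤ_p`). (Neukirch II (4.8), (6.2).) [folklore] -/
theorem norm_le_one_iff_isIntegral (y : PadicAlgCl p) : ‖y‖ ≤ 1 ↔ IsIntegral ℤ_[p] y := by
  have hy : IsIntegral ℚ_[p] y := Algebra.IsIntegral.isIntegral y
  rw [← PadicAlgCl.spectralNorm_eq]
  refine spectralNorm_le_one_iff_isIntegral (R := ℤ_[p]) (fun x ↦ ?_) hy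
  constructor
  · intro hx
    exact ⟨⟨x, hx⟩, rfl⟩
  · rintro ⟨r, rfl⟩
    exact r.2

/-- `‖p‖ = p⁻¹ < 1` in `ℚ̄_p` (a private copy of
`Literature.NumberTheory.Automorphic.PadicAlgCl.norm_natCast_p_lt_one`, whose module is a heavy
import). [folklore] -/
private theorem norm_natCast_prime_lt_one : ‖(p : PadicAlgCl p)‖ < 1 := by
  have hp : (p : ℕ).Prime := Fact.out
  rw [← map_natCast (algebraMap ℚ_[p] (PadicAlgCl p)), PadicAlgCl.norm_extends, Padic.norm_p]
  exact inv_lt_one_of_one_lt₀ (by exact_mod_cast hp.one_lt)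

/-! ### A finite subextension `E` and its unit ball `𝒪_E` -/

section Subextension

variable (E : IntermediateField ℚ_[p] (PadicAlgCl p))

/-- The norm of `E ⊆ ℚ̄_p` is the induced one. [folklore] -/
theorem norm_coe (x : E) : ‖x‖ = ‖(x : PadicAlgCl p)‖ := rfl

/-- Membership in `𝒪_E = {x ∈ E : ‖x‖ ≤ 1}` (the valuation subring of the restriction of
`Valued.v`). [folklore] -/
theorem mem_unitBall_iff (x : E) :
    x ∈ (Valued.v.comap (algebraMap E (PadicAlgCl p))).valuationSubring ↔
      ‖(x : PadicAlgCl p)‖ ≤ 1 := by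
  rw [Valuation.mem_valuationSubring_iff, Valuation.comap_apply, PadicAlgCl.valuation_def,
    ← NNReal.coe_le_coe, coe_nnnorm, NNReal.coe_one]
  rfl

/-- `E` is an ultrametric space. [folklore] -/
theorem isUltrametricDist : IsUltrametricDist E := by
  refine IsUltrametricDist.isUltrametricDist_of_forall_norm_add_le_max_norm fun x y ↦ ?_
  rw [norm_coe, norm_coe, norm_coe]
  exact PadicAlgCl.isNonarchimedean p _ _

/-- `E` is a normed `ℚ_p`-space for the induced norm (a theorem, not an instance). [folklore] -/
theorem normedSpace_nonempty : Nonempty (NormedSpace ℚ_[p] E) :=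
  ⟨{ norm_smul_le := fun r x ↦ by
      rw [norm_coe, norm_coe]
      change ‖((r • x : E) : PadicAlgCl p)‖ ≤ ‖r‖ * ‖(x : PadicAlgCl p)‖
      rw [IntermediateField.coe_smul, norm_smul] }⟩

/-- **`E` is complete** (finite-dimensional over the complete field `ℚ_p`). [folklore] -/
theorem completeSpace [FiniteDimensional ℚ_[p] E] : CompleteSpace E := by
  letI : NormedSpace ℚ_[p] E := (normedSpace_nonempty E).some
  exact FiniteDimensional.complete ℚ_[p] E

/-- `𝒪_E` is the integral closure of `ℤ_p` in `E` (as subrings). [folklore] -/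
theorem unitBall_toSubring_eq_integralClosure :
    (Valued.v.comap (algebraMap E (PadicAlgCl p))).valuationSubring.toSubring =
      (integralClosure ℤ_[p] E).toSubring := by
  haveI : IsScalarTower ℤ_[p] E (PadicAlgCl p) := IsScalarTower.of_algebraMap_eq fun x ↦ by
    rw [IsScalarTower.algebraMap_apply ℤ_[p] ℚ_[p] (PadicAlgCl p),
      IsScalarTower.algebraMap_apply ℤ_[p] ℚ_[p] E, ← IsScalarTower.algebraMap_apply ℚ_[p] E]
  ext x
  change x ∈ (Valued.v.comap (algebraMap E (PadicAlgCl p))).valuationSubring ↔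
    x ∈ integralClosure ℤ_[p] E
  rw [mem_unitBall_iff, mem_integralClosure_iff, norm_le_one_iff_isIntegral]
  exact isIntegral_algHom_iff (IsScalarTower.toAlgHom ℤ_[p] E (PadicAlgCl p))
    (algebraMap E (PadicAlgCl p)).injective

/-- `𝒪_E` is Noetherian (it is the integral closure of `ℤ_p` in the finite separable extension
`E/ℚ_p`, Mathlib `integralClosure.isNoetherianRing`; Serre, *Local Fields*, II §2 Prop. 3).
[cite: SerreLocalFields1979, Ch. II §2, Prop. 3] -/
theorem isNoetherianRing_unitBall [FiniteDimensional ℚ_[p] E] :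
    IsNoetherianRing (Valued.v.comap (algebraMap E (PadicAlgCl p))).valuationSubring := by
  haveI : IsNoetherianRing (integralClosure ℤ_[p] E) :=
    integralClosure.isNoetherianRing (A := ℤ_[p]) (K := ℚ_[p]) E
  exact isNoetherianRing_of_ringEquiv (integralClosure ℤ_[p] E)
    (RingEquiv.subringCongr (unitBall_toSubring_eq_integralClosure E).symm)

/-- Units of `𝒪_E` have norm `1`. [folklore] -/
theorem norm_eq_one_of_isUnit {x : (Valued.v.comap (algebraMap E (PadicAlgCl p))).valuationSubring}
    (hx : IsUnit x) : ‖((x : E) : PadicAlgCl p)‖ = 1 := by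
  obtain ⟨y, hy⟩ := isUnit_iff_exists_inv.mp hx
  set f := (algebraMap E (PadicAlgCl p)).comp
    (Valued.v.comap (algebraMap E (PadicAlgCl p))).valuationSubring.subtype with hf
  have h1 : ‖f x‖ ≤ 1 := (mem_unitBall_iff E _).mp x.2
  have h2 : ‖f y‖ ≤ 1 := (mem_unitBall_iff E _).mp y.2
  have hmul : ‖f x‖ * ‖f y‖ = 1 := by
    rw [← norm_mul, ← map_mul, hy, map_one, norm_one]
  change ‖f x‖ = 1
  exact le_antisymm h1 (by nlinarith [norm_nonneg (f x), norm_nonneg (f y)])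

/-- Elements of norm `1` are units of `𝒪_E`. [folklore] -/
theorem isUnit_of_norm_eq_one {x : (Valued.v.comap (algebraMap E (PadicAlgCl p))).valuationSubring}
    (hx : ‖((x : E) : PadicAlgCl p)‖ = 1) : IsUnit x := by
  have hx0 : (x : E) ≠ 0 := by
    intro h
    rw [h] at hx
    simp at hx
  have hinv : (x : E)⁻¹ ∈ (Valued.v.comap (algebraMap E (PadicAlgCl p))).valuationSubring := by
    rw [mem_unitBall_iff]
    push_cast
    rw [norm_inv, hx, inv_one]
  exact isUnit_iff_exists_inv.mpr ⟨⟨_, hinv⟩, Subtype.ext (mul_inv_cancel₀ hx0)⟩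

/-- **The maximal ideal of `𝒪_E` is `{‖x‖ < 1}`.** [folklore] -/
theorem mem_maximalIdeal_unitBall_iff
    (x : (Valued.v.comap (algebraMap E (PadicAlgCl p))).valuationSubring) :
    x ∈ maximalIdeal (Valued.v.comap (algebraMap E (PadicAlgCl p))).valuationSubring ↔
      ‖((x : E) : PadicAlgCl p)‖ < 1 := by
  rw [IsLocalRing.mem_maximalIdeal, mem_nonunits_iff]
  have hle : ‖((x : E) : PadicAlgCl p)‖ ≤ 1 := (mem_unitBall_iff E _).mp x.2
  constructor
  · intro h
    exact lt_of_le_of_ne hle fun heq ↦ h (isUnit_of_norm_eq_one E heq)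
  · intro h hu
    exact h.ne (norm_eq_one_of_isUnit E hu)

/-- `p ∈ 𝔪_E`. [folklore] -/
theorem natCast_mem_maximalIdeal_unitBall :
    ((p : ℕ) : (Valued.v.comap (algebraMap E (PadicAlgCl p))).valuationSubring) ∈
      maximalIdeal (Valued.v.comap (algebraMap E (PadicAlgCl p))).valuationSubring := by
  rw [mem_maximalIdeal_unitBall_iff]
  push_cast
  exact norm_natCast_prime_lt_one

/-- `𝒪_E` is not a field (`p` is a non-zero non-unit). [folklore] -/
theorem not_isField_unitBall :
    ¬ IsField (Valued.v.comap (algebraMap E (PadicAlgCl p))).valuationSubring := by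
  rw [IsLocalRing.isField_iff_maximalIdeal_eq]
  intro h
  have hp := natCast_mem_maximalIdeal_unitBall E
  rw [h, Ideal.mem_bot] at hp
  have : ((p : ℕ) : PadicAlgCl p) = 0 := by
    have := congrArg (fun w : (Valued.v.comap (algebraMap E (PadicAlgCl p))).valuationSubring ↦
      ((w : E) : PadicAlgCl p)) hp
    simpa using this
  exact (Fact.out : p.Prime).ne_zero (by exact_mod_cast this)

/-- **`𝒪_E` is a discrete valuation ring** (a Noetherian valuation ring which is not a field;
Serre, *Local Fields*, Ch. II §2, Prop. 3: the integral closure of `ℤ_p` in a finite extension of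
`ℚ_p` is a complete discrete valuation ring). [cite: SerreLocalFields1979, Ch. II §2, Prop. 3] -/
theorem isDiscreteValuationRing_unitBall [FiniteDimensional ℚ_[p] E] :
    IsDiscreteValuationRing (Valued.v.comap (algebraMap E (PadicAlgCl p))).valuationSubring := by
  haveI := isNoetherianRing_unitBall E
  have htfae :=
    IsDiscreteValuationRing.TFAE (Valued.v.comap (algebraMap E (PadicAlgCl p))).valuationSubring
      (not_isField_unitBall E)
  exact (htfae.out 0 1).mpr
    (inferInstance : ValuationRing (Valued.v.comap (algebraMap E (PadicAlgCl p))).valuationSubring)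

/-- The closed unit ball of `E` is `𝒪_E` (in the form used by
`spectralNorm_le_one_iff_isIntegral`). [folklore] -/
theorem norm_le_one_iff_mem_range (x : E) :
    ‖x‖ ≤ 1 ↔ x ∈ (algebraMap (Valued.v.comap (algebraMap E (PadicAlgCl p))).valuationSubring
      E).range := by
  rw [norm_coe, ← mem_unitBall_iff]
  constructor
  · intro hx
    exact ⟨⟨x, hx⟩, rfl⟩
  · rintro ⟨r, rfl⟩
    exact r.2

end Subextension

/-! ### Discrete valuation rings over `𝒪_E` inside finite extensions of `E` -/

section Transport

variable (E : IntermediateField ℚ_[p] (PadicAlgCl p)) [FiniteDimensional ℚ_[p] E]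

set_option maxHeartbeats 800000 in
/-- **Transport of integrality and of the maximal ideal along an `E`-embedding into `ℚ̄_p`.**
Let `E ⊆ ℚ̄_p` be finite over `ℚ_p` with unit ball `𝒪_E`, `K'` a finite extension field of `E`,
`𝒪'` a discrete valuation ring with fraction field `K'`, containing (the image of) `𝒪_E` and with
`p ∈ 𝔪'`, and `φ : K' → ℚ̄_p` an `E`-embedding.  Then `‖φ y‖ ≤ 1` for all `y ∈ 𝒪'` and
`‖φ y‖ < 1` for `y ∈ 𝔪'`.  (Uniqueness of the extension of the valuation of the complete field
`E` to `K'`: `𝒪'` is the unit ball of the spectral norm of `K'/E`, which is the integral closure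
of `𝒪_E`, and the norm of `ℚ̄_p` restricted along `φ` is that spectral norm; Serre, *Local
Fields*, Ch. II §2, Prop. 3 and Cor. 2.) [cite: SerreLocalFields1979, Ch. II §2, Prop. 3, Cor. 2] -/
theorem norm_algebraMap_le_one_of_dvr
    {K' : Type*} [Field K'] [Algebra E K'] [FiniteDimensional E K']
    [Algebra (Valued.v.comap (algebraMap E (PadicAlgCl p))).valuationSubring K']
    [IsScalarTower (Valued.v.comap (algebraMap E (PadicAlgCl p))).valuationSubring E K']
    {𝒪' : Type*} [CommRing 𝒪'] [IsDomain 𝒪'] [IsDiscreteValuationRing 𝒪'] [Algebra 𝒪' K']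
    [IsFractionRing 𝒪' K']
    [Algebra (Valued.v.comap (algebraMap E (PadicAlgCl p))).valuationSubring 𝒪']
    [IsScalarTower (Valued.v.comap (algebraMap E (PadicAlgCl p))).valuationSubring 𝒪' K']
    (hp : ((p : ℕ) : 𝒪') ∈ maximalIdeal 𝒪') (φ : K' →ₐ[E] PadicAlgCl p) (y : 𝒪') :
    ‖φ (algebraMap 𝒪' K' y)‖ ≤ 1 ∧ (y ∈ maximalIdeal 𝒪' → ‖φ (algebraMap 𝒪' K' y)‖ < 1) := by
  classical
  haveI hOdvr :
      IsDiscreteValuationRing (Valued.v.comap (algebraMap E (PadicAlgCl p))).valuationSubring :=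
    isDiscreteValuationRing_unitBall E
  haveI : IsUltrametricDist E := isUltrametricDist E
  haveI : CompleteSpace E := completeSpace E
  haveI : Algebra.IsAlgebraic E K' := Algebra.IsAlgebraic.of_finite E K'
  haveI : CharZero K' := charZero_of_injective_algebraMap (algebraMap E K').injective
  have hp' : (p : ℕ).Prime := Fact.out
  -- ### the spectral norm of `K'/E` (multiplicative, `E` being complete) and its unit ball `A'`
  letI instK' : NormedField K' := spectralNorm.normedField E K'
  have hnormK' : ∀ z : K', ‖z‖ = spectralNorm E K' z := fun _ ↦ rfl
  haveI : IsUltrametricDist K' :=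
    IsUltrametricDist.isUltrametricDist_of_forall_norm_add_le_max_norm fun x y ↦
      isNonarchimedean_spectralNorm x y
  let A' : ValuationSubring K' := (NormedField.valuation (K := K')).valuationSubring
  have hA' : ∀ z : K', z ∈ A' ↔ spectralNorm E K' z ≤ 1 := fun z ↦ by
    rw [Valuation.mem_valuationSubring_iff, NormedField.valuation_apply, ← NNReal.coe_le_coe,
      coe_nnnorm, NNReal.coe_one, hnormK']
  -- `A'` is the integral closure of `𝒪_E`
  have hA'int : ∀ z : K',
      z ∈ A' ↔ IsIntegral (Valued.v.comap (algebraMap E (PadicAlgCl p))).valuationSubring z :=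
      fun z ↦ by
    rw [hA']
    exact spectralNorm_le_one_iff_isIntegral (norm_le_one_iff_mem_range E)
      (Algebra.IsIntegral.isIntegral z)
  -- ### the valuation subring `B` of `K'` defined by `𝒪'`
  let val := ValuationRing.valuation 𝒪' K'
  let B : ValuationSubring K' := val.valuationSubring
  have hB : ∀ x : K', x ∈ B ↔ ∃ s : 𝒪', algebraMap 𝒪' K' s = x := fun x ↦ by
    rw [Valuation.mem_valuationSubring_iff, ← Valuation.mem_integer_iff]
    exact ValuationRing.mem_integer_iff 𝒪' K' x
  have hinj : Function.Injective (algebraMap 𝒪' K') := IsFractionRing.injective 𝒪' K'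
  -- units of `B` come from units of `𝒪'`
  have hunit : ∀ (s : 𝒪') (hs : algebraMap 𝒪' K' s ∈ B), IsUnit (⟨algebraMap 𝒪' K' s, hs⟩ : B) →
      IsUnit s := by
    intro s hs hsu
    obtain ⟨u, hu⟩ := hsu
    obtain ⟨t, ht⟩ := (hB _).mp ((u⁻¹ : Bˣ) : B).2
    have h1 : ((u : B) : K') * (((u⁻¹ : Bˣ) : B) : K') = 1 := by
      have := congrArg (fun w : B ↦ (w : K')) u.mul_inv
      rwa [MulMemClass.coe_mul, OneMemClass.coe_one] at this
    rw [hu, ← ht, ← map_mul] at h1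
    change algebraMap 𝒪' K' (s * t) = 1 at h1
    rw [← map_one (algebraMap 𝒪' K')] at h1
    exact isUnit_iff_exists_inv.mpr ⟨t, hinj h1⟩
  -- `p` is a non-unit of `B`, so `B ≠ ⊤`
  have hpB : ((p : ℕ) : K') ∈ B := (hB _).mpr ⟨p, by simp⟩
  have hpB' : algebraMap 𝒪' K' p ∈ B := by simp [hpB]
  have hpnu : ¬ IsUnit (⟨((p : ℕ) : K'), hpB⟩ : B) := by
    intro h
    have h' : IsUnit (⟨algebraMap 𝒪' K' p, hpB'⟩ : B) := by
      have : (⟨algebraMap 𝒪' K' p, hpB'⟩ : B) = ⟨((p : ℕ) : K'), hpB⟩ := Subtype.ext (by simp)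
      rw [this]; exact h
    exact (IsLocalRing.mem_maximalIdeal _).mp hp (hunit _ _ h')
  have hp0 : ((p : ℕ) : K') ≠ 0 := Nat.cast_ne_zero.mpr hp'.ne_zero
  have hBtop : B ≠ ⊤ := by
    intro h
    have hinv : ((p : ℕ) : K')⁻¹ ∈ B := h ▸ trivial
    refine hpnu (isUnit_iff_exists_inv.mpr ⟨⟨_, hinv⟩, Subtype.ext ?_⟩)
    simp [mul_inv_cancel₀ hp0]
  -- ### `A' ≤ B` (`𝒪'` is integrally closed and contains `O`)
  have hle : A' ≤ B := by
    intro z hz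
    have hzO : IsIntegral (Valued.v.comap (algebraMap E (PadicAlgCl p))).valuationSubring z :=
      (hA'int z).mp hz
    have hz' : IsIntegral 𝒪' z := hzO.tower_top
    obtain ⟨s, hs⟩ := (IsIntegrallyClosed.isIntegral_iff (R := 𝒪') (K := K')).mp hz'
    exact (hB z).mpr ⟨s, hs⟩
  -- ### `A'` is a discrete valuation ring
  have hA'sub : A'.toSubring =
      (integralClosure
        (Valued.v.comap (algebraMap E (PadicAlgCl p))).valuationSubring K').toSubring := by
    ext z
    change z ∈ A' ↔
      z ∈ integralClosure (Valued.v.comap (algebraMap E (PadicAlgCl p))).valuationSubring K'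
    rw [hA'int, mem_integralClosure_iff]
  haveI : IsNoetherianRing A' := by
    haveI : IsNoetherianRing
        (integralClosure (Valued.v.comap (algebraMap E (PadicAlgCl p))).valuationSubring K') :=
      integralClosure.isNoetherianRing
        (A := (Valued.v.comap (algebraMap E (PadicAlgCl p))).valuationSubring) (K := E) K'
    exact isNoetherianRing_of_ringEquiv
      (integralClosure (Valued.v.comap (algebraMap E (PadicAlgCl p))).valuationSubring K')
      (RingEquiv.subringCongr hA'sub.symm)
  have hpE : ‖((p : ℕ) : E)‖ < 1 := by
    rw [norm_coe]
    push_cast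
    exact norm_natCast_prime_lt_one
  have hpA' : ((p : ℕ) : K') ∈ A' := by
    rw [hA', ← map_natCast (algebraMap E K'), spectralNorm_extends]
    exact hpE.le
  have hA'unit : ∀ z : A', IsUnit z → spectralNorm E K' (z : K') = 1 := by
    intro z hz
    obtain ⟨u, rfl⟩ := hz
    have h1 : spectralNorm E K' ((u : A') : K') ≤ 1 := (hA' _).mp (SetLike.coe_mem _)
    have h2 : spectralNorm E K' (((u⁻¹ : A'ˣ) : A') : K') ≤ 1 := (hA' _).mp (SetLike.coe_mem _)
    have hmul : spectralNorm E K' ((u : A') : K') * spectralNorm E K' (((u⁻¹ : A'ˣ) : A') : K') =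
        1 := by
      rw [← hnormK', ← hnormK', ← norm_mul]
      have := congrArg (fun w : A' ↦ (w : K')) u.mul_inv
      rw [MulMemClass.coe_mul, OneMemClass.coe_one] at this
      rw [this, norm_one]
    have h0 : 0 ≤ spectralNorm E K' ((u : A') : K') := spectralNorm_nonneg _
    exact le_antisymm h1 (by nlinarith)
  have hA'nf : ¬ IsField A' := by
    rw [IsLocalRing.isField_iff_maximalIdeal_eq]
    intro h
    have hmem : (⟨((p : ℕ) : K'), hpA'⟩ : A') ∈ maximalIdeal A' := by
      rw [IsLocalRing.mem_maximalIdeal, mem_nonunits_iff]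
      intro hu
      have := hA'unit _ hu
      change spectralNorm E K' ((p : ℕ) : K') = 1 at this
      rw [← map_natCast (algebraMap E K'), spectralNorm_extends] at this
      exact hpE.ne this
    rw [h, Ideal.mem_bot] at hmem
    exact hp0 (congrArg (fun w : A' ↦ (w : K')) hmem)
  haveI : IsDiscreteValuationRing A' := by
    have htfae := IsDiscreteValuationRing.TFAE (↥A') hA'nf
    exact (htfae.out 0 1).mpr (inferInstance : ValuationRing (↥A'))
  -- ### hence `A' = B`
  have hAB : A' = B := ValuationSubring.eq_of_le_of_ne_top A' hle hBtop
  have hmemB : ∀ z : K', z ∈ B ↔ spectralNorm E K' z ≤ 1 := fun z ↦ by rw [← hAB, hA']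
  -- ### the norm of `ℚ̄_p` along `φ` is the spectral norm of `K'/E`
  letI : NormedAlgebra E (PadicAlgCl p) :=
    { (inferInstance : Algebra E (PadicAlgCl p)) with
      norm_smul_le := fun r x ↦ by rw [Algebra.smul_def, norm_mul]; rfl }
  haveI : Algebra.IsAlgebraic E (PadicAlgCl p) := Algebra.IsAlgebraic.tower_top (K := ℚ_[p]) E
  have hφ : ∀ z : K', ‖φ z‖ = spectralNorm E K' z := by
    intro z
    rw [NormedAlgebra.norm_eq_spectralNorm E (φ z), spectralNorm, spectralNorm,
      minpoly.algHom_eq φ φ.toRingHom.injective z]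
  -- ### conclusion
  have hyB : algebraMap 𝒪' K' y ∈ B := (hB _).mpr ⟨y, rfl⟩
  refine ⟨by rw [hφ]; exact (hmemB _).mp hyB, fun hy ↦ ?_⟩
  rw [hφ]
  refine lt_of_le_of_ne ((hmemB _).mp hyB) fun heq ↦ ?_
  -- spectral norm `= 1` would make `y` a unit of `B`, hence of `𝒪'`
  have hy0 : algebraMap 𝒪' K' y ≠ 0 := fun h ↦ by
    rw [h, spectralNorm_zero] at heq
    exact zero_ne_one heq
  have hinvB : (algebraMap 𝒪' K' y)⁻¹ ∈ B := by
    rw [hmemB, ← hnormK', norm_inv, hnormK', heq, inv_one]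
  have hu : IsUnit (⟨algebraMap 𝒪' K' y, hyB⟩ : B) :=
    isUnit_iff_exists_inv.mpr ⟨⟨_, hinvB⟩, Subtype.ext (mul_inv_cancel₀ hy0)⟩
  exact (IsLocalRing.mem_maximalIdeal _).mp hy (hunit _ _ hu)

end Transport

end PadicAlgCl

end Literature.NumberTheory.GaloisRepresentations

end
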